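import Summits.BirchSwinnertonDyer.BirchSwinnertonDyer.Theorems.Rank2ObservatoryRank3RootNumberCerts01
import Summits.BirchSwinnertonDyer.BirchSwinnertonDyer.Theorems.Rank2ObservatoryRank3RootNumberCerts02
import Summits.BirchSwinnertonDyer.BirchSwinnertonDyer.Theorems.Rank2ObservatoryRank3RootNumberCerts03
import Summits.BirchSwinnertonDyer.BirchSwinnertonDyer.Theorems.Rank2ObservatoryRank3RootNumberCerts04
import Summits.BirchSwinnertonDyer.BirchSwinnertonDyer.Theorems.Rank2ObservatoryRank3RootNumberCerts05
import Summits.BirchSwinnertonDyer.BirchSwinnertonDyer.Theorems.Rank2ObservatoryRank3RootNumberCerts06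
import Summits.BirchSwinnertonDyer.BirchSwinnertonDyer.Theorems.Rank2ObservatoryRank3RootNumberCerts07
import Summits.BirchSwinnertonDyer.BirchSwinnertonDyer.Theorems.Rank2ObservatoryRank3RootNumberCerts08
import Summits.BirchSwinnertonDyer.BirchSwinnertonDyer.Theorems.Rank2ObservatoryRank3RootNumberCerts09
import Summits.BirchSwinnertonDyer.BirchSwinnertonDyer.Theorems.Rank2ObservatoryRank3RootNumberCerts10
import Summits.BirchSwinnertonDyer.BirchSwinnertonDyer.Theorems.Rank2ObservatoryRank3RootNumberCerts11
import Summits.BirchSwinnertonDyer.BirchSwinnertonDyer.Theorems.Rank2ObservatoryRank3RootNumberCerts12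
import Summits.BirchSwinnertonDyer.BirchSwinnertonDyer.Theorems.Rank2ObservatoryRank3RootNumberCerts13
import Summits.BirchSwinnertonDyer.BirchSwinnertonDyer.Theorems.Rank2ObservatoryRank3RootNumberCerts14
import Summits.BirchSwinnertonDyer.BirchSwinnertonDyer.Theorems.Rank2ObservatoryRank3RootNumberCerts15
import Summits.BirchSwinnertonDyer.BirchSwinnertonDyer.Theorems.Rank2ObservatoryRank3RootNumberCerts16
import Summits.BirchSwinnertonDyer.BirchSwinnertonDyer.Theorems.Rank2ObservatoryRank3RootNumberCerts17
import Summits.BirchSwinnertonDyer.BirchSwinnertonDyer.Theorems.Rank2ObservatoryRank3RootNumberCerts18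
import Summits.BirchSwinnertonDyer.BirchSwinnertonDyer.Theorems.Rank2ObservatoryRank3RootNumberCerts19
import Summits.BirchSwinnertonDyer.BirchSwinnertonDyer.Theorems.Rank2ObservatoryRank3RootNumberCerts20
import Summits.BirchSwinnertonDyer.BirchSwinnertonDyer.Theorems.Rank2ObservatoryRank3RootNumberCerts21
import Summits.BirchSwinnertonDyer.BirchSwinnertonDyer.Theorems.Rank2ObservatoryRank3RootNumberCerts22
import Summits.BirchSwinnertonDyer.BirchSwinnertonDyer.Theorems.Rank2ObservatoryRank3RootNumberCerts23
import Summits.BirchSwinnertonDyer.BirchSwinnertonDyer.Theorems.Rank2ObservatoryRank3RootNumberCerts24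
import Summits.BirchSwinnertonDyer.BirchSwinnertonDyer.Theorems.Rank2ObservatoryRank3RootNumberCerts25
import Summits.BirchSwinnertonDyer.BirchSwinnertonDyer.Theorems.Rank2ObservatoryRank3RootNumberCerts26
import Summits.BirchSwinnertonDyer.BirchSwinnertonDyer.Theorems.Rank2ObservatoryRank3RootNumberCerts27
import Summits.BirchSwinnertonDyer.BirchSwinnertonDyer.Theorems.Rank2ObservatoryRank3KernelCertsCensus
import HarnessLib

/-!
# BSD rank ≥ 2 observatory (`b2b-bsdr2`): the rank-3 census with the ROOT NUMBER DISCHARGED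
# (kernel certificates, modulo the named fact `rootNumber_eq_neg_finprod_tableLocalRootNumberAt'`)

HONEST FRAMING: per-curve certified theorems and census instruments; no claim on BSD in rank ≥ 2.

Assembly of the 27 kernel-checked root-number certificate chunks
(`Rank2ObservatoryRank3RootNumberCertsNN`, theorems `rank3RowsNN_rnCheck`) over the whole rank-3
census table `rank3Table` (9 487 curves of rank 3 and conductor `< 500 000`, Cremona):

* `rank3RNCerts`, `rank3Table_rnCheck` — the aligned certificate list and its check on all rows;
* `rank3RNCerts_count` — exactly `7937` rows carry a certificate (kernel count): every row with
  no additive reduction at `3` (the other `1550` rows are additive at `3`, where the named fact is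
  guarded — no `ℚ₃` table in the tree);
* `Rank3Row.rootNumberCertified_of_idx` / `_of_mem_zip` — row `i` (resp. a listed pair) is
  `RootNumberCertified`;
* (`Rank3Row.rootNumber_eq_neg_one_of_certified`, file `…Rank3RootNumber`) — **`w(E) = −1`** for a
  certified row GIVEN ONLY the named fact
  `WeierstrassCurve.rootNumber_eq_neg_finprod_tableLocalRootNumberAt'` (Kellock–Dokchitser 2023,
  Def. 2.1, Thm. 2.3, §5 table with rows `(0,5,2)` corrected after Rizzo 2003) as hypothesis `hKD`:
  the local root numbers are EVALUATED IN THE KERNEL (corrected `ℚ₂` table at `2`; split /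
  non-split multiplicative at the odd bad primes by a root / an Euler witness; Rohrlich's formula
  from `ord_p Δ`, `ord_p c₄` at the additive primes `p ≥ 5`; `+1` elsewhere);
* `Rank3Row.analyticRank_eq_rank_kernel_rn`, `Rank3Row.rank3_lderiv_eq_zero_kernel_rn` — the census
  headline theorems of `Rank2ObservatoryRank3KernelCertsCensus` with the hypothesis
  `hw : rootNumber = −1` REPLACED by `hKD` for the certified rows.

What stays a hypothesis: `hKD` itself (modularity + local Langlands + the `ℚ₂` ε-factor tables; a
named fact of the tree, not proved there), `hGZK`, `rank ≤ 3`, `L‴(E,1) ≠ 0` as before; and `hw` for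
the 1 550 uncertified rows.  Cross-checks outside the proofs (unit records, job `j096884`): PARI
`ellrootno` gives `w(E) = −1` for all 9 487 rows and agrees with each of the 23 115 local signs at
odd bad primes computed by the generator (20 181 of them in the certificates); the Lean evaluator
agrees with the kernel on all 7 937 certificates.

References: Kellock–Dokchitser 2023 [KellockDokchitser2023]; Rizzo 2003 [Rizzo2003]; Rohrlich 1993
[Rohrlich1993Compositio]; Cremona 1997 [CremonaAlgorithms1997]; Gross–Zagier–Kolyvagin as in
`Rank2ObservatoryRank3KernelCertsCensus` [Darmon2004].
-/

set_option linter.dupNamespace false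
set_option autoImplicit false

open WeierstrassCurve Literature Literature.NumberTheory.EllipticCurves

namespace Summit.BirchSwinnertonDyer.BirchSwinnertonDyer.Rank2Observatory

open RootNumber

/-- The root-number certificates of the whole census, aligned with `rank3Table` (27 chunks).
[cite: KellockDokchitser2023, Notation 5.1 and §5] -/
def rank3RNCerts : List (Option RNCert) :=
  rank3RNCerts01 ++ rank3RNCerts02 ++ rank3RNCerts03 ++ rank3RNCerts04 ++ rank3RNCerts05 ++
    rank3RNCerts06 ++ rank3RNCerts07 ++ rank3RNCerts08 ++ rank3RNCerts09 ++ rank3RNCerts10 ++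
    rank3RNCerts11 ++ rank3RNCerts12 ++ rank3RNCerts13 ++ rank3RNCerts14 ++ rank3RNCerts15 ++
    rank3RNCerts16 ++ rank3RNCerts17 ++ rank3RNCerts18 ++ rank3RNCerts19 ++ rank3RNCerts20 ++
    rank3RNCerts21 ++ rank3RNCerts22 ++ rank3RNCerts23 ++ rank3RNCerts24 ++ rank3RNCerts25 ++
    rank3RNCerts26 ++ rank3RNCerts27

/-- **Every listed certificate checks on its row** (the 27 kernel chunk theorems, concatenated).
[cite: KellockDokchitser2023, Thm. 2.3 and §5] -/
theorem rank3Table_rnCheck : rnRowsCheck rank3Table rank3RNCerts = true := by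
  unfold rank3Table rank3RNCerts
  have h := rank3Rows01_rnCheck
  have h := rnRowsCheck_append _ _ _ _ h rank3Rows02_rnCheck
  have h := rnRowsCheck_append _ _ _ _ h rank3Rows03_rnCheck
  have h := rnRowsCheck_append _ _ _ _ h rank3Rows04_rnCheck
  have h := rnRowsCheck_append _ _ _ _ h rank3Rows05_rnCheck
  have h := rnRowsCheck_append _ _ _ _ h rank3Rows06_rnCheck
  have h := rnRowsCheck_append _ _ _ _ h rank3Rows07_rnCheck
  have h := rnRowsCheck_append _ _ _ _ h rank3Rows08_rnCheck
  have h := rnRowsCheck_append _ _ _ _ h rank3Rows09_rnCheck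
  have h := rnRowsCheck_append _ _ _ _ h rank3Rows10_rnCheck
  have h := rnRowsCheck_append _ _ _ _ h rank3Rows11_rnCheck
  have h := rnRowsCheck_append _ _ _ _ h rank3Rows12_rnCheck
  have h := rnRowsCheck_append _ _ _ _ h rank3Rows13_rnCheck
  have h := rnRowsCheck_append _ _ _ _ h rank3Rows14_rnCheck
  have h := rnRowsCheck_append _ _ _ _ h rank3Rows15_rnCheck
  have h := rnRowsCheck_append _ _ _ _ h rank3Rows16_rnCheck
  have h := rnRowsCheck_append _ _ _ _ h rank3Rows17_rnCheck
  have h := rnRowsCheck_append _ _ _ _ h rank3Rows18_rnCheck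
  have h := rnRowsCheck_append _ _ _ _ h rank3Rows19_rnCheck
  have h := rnRowsCheck_append _ _ _ _ h rank3Rows20_rnCheck
  have h := rnRowsCheck_append _ _ _ _ h rank3Rows21_rnCheck
  have h := rnRowsCheck_append _ _ _ _ h rank3Rows22_rnCheck
  have h := rnRowsCheck_append _ _ _ _ h rank3Rows23_rnCheck
  have h := rnRowsCheck_append _ _ _ _ h rank3Rows24_rnCheck
  have h := rnRowsCheck_append _ _ _ _ h rank3Rows25_rnCheck
  have h := rnRowsCheck_append _ _ _ _ h rank3Rows26_rnCheck
  have h := rnRowsCheck_append _ _ _ _ h rank3Rows27_rnCheck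
  exact h

/-- The certificate list is aligned with the table: `9487` entries. [cite: CremonaAlgorithms1997, Tables] -/
theorem rank3RNCerts_length : rank3RNCerts.length = 9487 := by
  rw [← length_eq_of_rnRowsCheck _ _ rank3Table_rnCheck, rank3Table_length]

/-- **Exactly `7937` of the `9487` rows carry a root-number certificate** (kernel count).
[cite: CremonaAlgorithms1997, Tables] -/
theorem rank3RNCerts_count : rank3RNCerts.countP Option.isSome = 7937 := by
  decide +kernel

/-- Row `i` of the census with a listed certificate is root-number certified. [folklore] -/
theorem Rank3Row.rootNumberCertified_of_idx {i : ℕ} (hi : i < rank3Table.length) {c : RNCert}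
    (hc : rank3RNCerts[i]? = some (some c)) : (rank3Table[i]'hi).RootNumberCertified :=
  certified_of_rnRowsCheck _ _ rank3Table_rnCheck i hi c hc

/-- Membership form: a pair `(row, some c)` of the aligned lists is a certified row. [folklore] -/
theorem Rank3Row.rootNumberCertified_of_mem_zip {r : Rank3Row} {c : RNCert}
    (h : (r, some c) ∈ rank3Table.zip rank3RNCerts) : r.RootNumberCertified :=
  certified_of_mem_zip rank3Table_rnCheck h

/-- **`r_an(E) = rank_ℤ E(ℚ) (= 3)` for every CERTIFIED row of the rank-3 census with `hlow` AND THE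
ROOT NUMBER discharged in the kernel**: the remaining hypotheses are Gross–Zagier–Kolyvagin, `rank ≤ 3`,
`L‴(E,1) ≠ 0` and the named fact `hKD` (in place of `hw`). [cite: KellockDokchitser2023, Thm. 2.3 and §5]
[cite: Darmon2004, Thm. 3.22] -/
theorem Rank3Row.analyticRank_eq_rank_kernel_rn {r : Rank3Row} (hr : r ∈ rank3Table)
    (hrc : r.RootNumberCertified) (hGZK : rank_eq_analyticRank_of_analyticRank_le_one)
    (hup : r.curve.mordellWeilRank ≤ 3) (hL3 : iteratedDeriv 3 r.curve.entireLFunction 1 ≠ 0)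
    (hKD : r.curve.rootNumber_eq_neg_finprod_tableLocalRootNumberAt') :
    r.curve.analyticRank = r.curve.mordellWeilRank :=
  Rank3Row.analyticRank_eq_rank_kernel hr hGZK hup hL3 (Rank3Row.rootNumber_eq_neg_one_of_certified hrc hKD)

/-- **`L′(E,1) = 0` over `K = ℚ(√D)` for every CERTIFIED row with `hlow` and the root number
discharged** (the named fact `hKD` in place of `hw`). [cite: KellockDokchitser2023, Thm. 2.3 and §5]
[cite: GrossLMS1991, (1.1) and Thm. 1.3] -/
theorem Rank3Row.rank3_lderiv_eq_zero_kernel_rn {r : Rank3Row} (hr : r ∈ rank3Table)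
    (hrc : r.RootNumberCertified) (K : Type) [Field K] [NumberField K]
    (hE : WeierstrassCurve.hasEntireLFunction_rat)
    (hGZKK : mordellWeilRank_eq_one_of_LDerivEK_ne_zero r.curve K)
    (hmin : r.curve.IsGloballyMinimal) (hN : r.curve.conductorNorm ℤ = r.N)
    (hK : IsImaginaryQuadratic K) (hdK : NumberField.discr K = r.D)
    (hKD : r.curve.rootNumber_eq_neg_finprod_tableLocalRootNumberAt')
    (hLD : (r.curve.quadraticTwist (r.D : ℚ)).entireLFunction 1 ≠ 0) :
    deriv r.curve.entireLFunction 1 = 0 :=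
  Rank3Row.rank3_lderiv_eq_zero_kernel hr K hE hGZKK hmin hN hK hdK (Rank3Row.rootNumber_eq_neg_one_of_certified hrc hKD)
    hLD

/-- The first row, `5077a1`, is root-number certified (certificate `⟨0, 4, 3, [(5077: non-split)]⟩`;
kernel). [cite: CremonaAlgorithms1997, Tables] -/
theorem rootNumberCertified_5077a1 :
    (⟨"5077a1", 0, 0, 1, -7, 6, 5077, -7, 4792, (1, 0, 1), (2, 0, 1), (0, 2, 1)⟩ : Rank3Row).RootNumberCertified :=
  ⟨⟨0, 4, 3, [⟨5077, 71, 1, 0, 0⟩]⟩, by decide +kernel, by decide +kernel⟩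

end Summit.BirchSwinnertonDyer.BirchSwinnertonDyer.Rank2Observatory
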